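import Literature.Probability.LatticeModels.PlusStateHeatBath
import Summits.CriticalPhenomena.Ising3DConformalLimit.Theorems.SubPtolemyInterlacingSubPtolemyFloorSteinCovariance
import HarnessLib

/-!
# Stein decorrelation `⟨Ψ^A_0 Ψ^B_z⟩ = 0` (min-rule form)

Stub `stub_steinDecorrelation` (S3) of the line `Sketch` (idea `stein-cramer-rao-dual-witness`) for the
crux `SubPtolemyFloor` (stmt-CriticalPhenomena-15703, route decl
`Summit.CriticalPhenomena.Ising3DConformalLimit.Theses.SubPtolemyInterlacing.SubPtolemyFloor`).

Notation: `β ≥ 0`, `⟨·⟩ = plusExpect d β 0` (the plus state), `S_x σ = ∑_{y ∼ x} σ_y`,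
`t_x = tanh(β S_x)`, the DLR score `g_x = σ_x − t_x`; for local functionals `A` (reading the finite set
`K`) and `B` (reading `K'`), `B_z σ = B (σ(· + z))` (reads `K' + z`) and the Stein fields
`Ψ^A_0 = A g_0`, `Ψ^B_z = B_z g_z`. The identity proved here (for every `d`, every `β ≥ 0`, then
specialised to `d = 3`, `β = β_c(3)`):

  `⟨(A g_0) (B_z g_z)⟩ = 0` whenever `0 ∉ K`, `−z ∉ K'`, `z ≠ 0` and `z ≁ 0`.

Proof: regroup pointwise as `g_0 · (A B_z g_z)`; the local functional `A B_z g_z` reads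
`K ∪ (K' + z) ∪ {z} ∪ N(z)`, which does not contain the site `0` under the four hypotheses, so the
DLR score `g_0` is centred against it (`plusExpect_score_mul_eq_zero`, the heat-bath identity at the
site `0` in the plus state).
-/

noncomputable section

namespace Summit.CriticalPhenomena.Ising3DConformalLimit.SubPtolemyFloorStein

open Finset MeasureTheory Literature.Probability.LatticeModels

/-- **Stein decorrelation** (general `d`, `β ≥ 0`): for local `A` reading `K ∌ 0`, local `B` reading
`K' ∌ -z`, and a site `z ≠ 0` not adjacent to `0`,
`⟨(A g_0) · (B_z g_z)⟩⁺_{β,0} = 0`, where `g_x = σ_x − tanh(β S_x)` is the DLR score and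
`B_z σ = B (σ(· + z))`. The score `g_0` is centred against the local functional `A B_z g_z`, which does
not read `σ_0` (`plusExpect_score_mul_eq_zero`). [folklore] -/
theorem dec_main {d : ℕ} {β : ℝ} (hβ : 0 ≤ β) {K K' : Finset (Site d)}
    {A B : SpinConfig (Site d) → ℝ} {z : Site d} (hK : (0 : Site d) ∉ K)
    (hA : DependsOn A (↑K : Set (Site d))) (hB : DependsOn B (↑K' : Set (Site d)))
    (hz : z ≠ 0) (hadj : ¬ (zdGraph d).Adj 0 z) (hzK' : -z ∉ K') :
    plusExpect d β 0 (fun σ =>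
      (A σ * (spinAt 0 σ - Real.tanh (β * ∑ y ∈ (zdGraph d).neighborFinset 0, spinAt y σ))) *
      (B (fun y => σ (y + z)) * (spinAt z σ - Real.tanh (β *
          ∑ y ∈ (zdGraph d).neighborFinset z, spinAt y σ)))) = 0 := by
  -- the support of the local functional `A B_z g_z`
  have hg : DependsOn (fun σ : SpinConfig (Site d) => A σ * (B (fun y => σ (y + z)) *
      (spinAt z σ - Real.tanh (β * ∑ y ∈ (zdGraph d).neighborFinset z, spinAt y σ))))
      (↑(K ∪ (K'.image (· + z) ∪ ({z} ∪ (zdGraph d).neighborFinset z))) : Set (Site d)) :=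
    cov_dependsOn_mul hA (cov_dependsOn_mul (dependsOn_comp_add K' hB z)
      (cov_dependsOn_sub (cov_dependsOn_spinAt z) (cov_dependsOn_tanh β z)))
  -- ... which does not contain the site `0`
  have h0 : (0 : Site d) ∉ K ∪ (K'.image (· + z) ∪ ({z} ∪ (zdGraph d).neighborFinset z)) :=
    fun h => by
      rcases Finset.mem_union.1 h with h | h
      · exact hK h
      rcases Finset.mem_union.1 h with h | h
      · obtain ⟨k, hk, hkz⟩ := Finset.mem_image.1 h
        have hkz : k + z = 0 := hkz
        rw [eq_neg_of_add_eq_zero_left hkz] at hk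
        exact hzK' hk
      rcases Finset.mem_union.1 h with h | h
      · exact hz (Finset.mem_singleton.1 h).symm
      · exact hadj ((SimpleGraph.mem_neighborFinset _ _ _).1 h).symm
  -- regroup pointwise as `g_0 · (A B_z g_z)`
  have e : (fun σ : SpinConfig (Site d) =>
      (A σ * (spinAt 0 σ - Real.tanh (β * ∑ y ∈ (zdGraph d).neighborFinset 0, spinAt y σ))) *
      (B (fun y => σ (y + z)) * (spinAt z σ - Real.tanh (β *
          ∑ y ∈ (zdGraph d).neighborFinset z, spinAt y σ)))) =
      fun σ => (spinAt 0 σ - Real.tanh (β * ∑ y ∈ (zdGraph d).neighborFinset 0, spinAt y σ)) *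
        (A σ * (B (fun y => σ (y + z)) * (spinAt z σ - Real.tanh (β *
          ∑ y ∈ (zdGraph d).neighborFinset z, spinAt y σ)))) := funext fun σ => by ring
  rw [e]
  exact plusExpect_score_mul_eq_zero hβ 0 hg h0

/-- **S3 — Stein decorrelation, min-rule form** (card Lemma 1/1′) at `β = β_c(3)` on `ℤ³`:
`⟨Ψ^A_0 Ψ^B_z⟩ = 0` as soon as the spin at `0` is read by none of `A` (`0 ∉ K`), `B_z` (`-z ∉ K'`)
and `g_z` (`z ≠ 0`, `z ≁ 0`), where `Ψ^A_0 = A g_0`, `Ψ^B_z = B_z g_z`, `B_z σ = B (σ(· + z))` and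
`g_x = σ_x − tanh(β_c S_x)` is the DLR score: heat-bath at the site `0` (`dec_main`). Exact
finite-range decorrelation of Stein fields, a tool for the engine. [folklore] -/
theorem stub_steinDecorrelation :
    ∀ (K K' : Finset (Site 3)) (A B : SpinConfig (Site 3) → ℝ) (z : Site 3),
      (0 : Site 3) ∉ K → DependsOn A (↑K : Set (Site 3)) → DependsOn B (↑K' : Set (Site 3)) →
      z ≠ 0 → ¬ (zdGraph 3).Adj 0 z → -z ∉ K' →
        plusExpect 3 (criticalBeta 3) 0 (fun σ =>
          (A σ * (spinAt 0 σ - Real.tanh (criticalBeta 3 *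
              ∑ y ∈ (zdGraph 3).neighborFinset 0, spinAt y σ))) *
          (B (fun y => σ (y + z)) * (spinAt z σ - Real.tanh (criticalBeta 3 *
              ∑ y ∈ (zdGraph 3).neighborFinset z, spinAt y σ)))) = 0 :=
  fun _ _ _ _ _ hK hA hB hz hadj hzK' => dec_main (criticalBeta_nonneg 3) hK hA hB hz hadj hzK'

end Summit.CriticalPhenomena.Ising3DConformalLimit.SubPtolemyFloorStein

end
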